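import Mathlib.Analysis.Calculus.Deriv.Shift
import Literature.Analysis.FluidPDE.CompressibleEulerImplosionAssembly
import Literature.Analysis.FluidPDE.CompressibleEulerImplosionSonicAnalytic
import Literature.Analysis.FluidPDE.CompressibleEulerImplosionP0Entry
import Literature.Analysis.FluidPDE.CompressibleEulerImplosionRegularity
import HarnessLib

/-!
# Buckmaster–Cao-Labora–Gómez-Serrano at `γ = 5/3`: Theorem 1.1 from a successful shooting

Topic `Literature/Analysis/FluidPDE`; namespace
`Literature.Analysis.FluidPDE.BuckmasterCaolaboraGomezserrano2025.Monatomic`. Companion of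
`CompressibleEulerImplosion.lean` (named fact `BuckmasterCaolaboraGomezserrano2025_thm11_monatomic`,
THEOREM 1.1 of T. Buckmaster, G. Cao-Labora, J. Gómez-Serrano, *Smooth imploding solutions for 3D
compressible fluids*, Forum Math. Pi 13 (2025) e6, arXiv:2208.09445, at `γ = 5/3`, `α = 1/3`);
uses `CompressibleEulerImplosionAssembly.lean` (G-glue `thm11_monatomic_of_WZ`),
`CompressibleEulerImplosionSonicAnalytic.lean` (the analytic branch `(Wloc r, Zloc r)` through
`P_s`, Props. 2.2–2.3), `CompressibleEulerImplosionP0Entry.lean` (`WofProfile`, `ZofProfile`),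
`CompressibleEulerImplosionRegularity.lean` (solutions off the sonic lines are `C^∞`) and
`CompressibleEulerImplosionUniqueness.lean` (local uniqueness off the sonic lines).

Brick G1 of the discharge plan — the last paragraph of §6 ("Therefore, by the uniqueness in
Proposition 1.6, for `r = r^{(3)}` we have `(W^{(r)}, Z^{(r)}) = (W_r^o, Z_r^o)`. Thus the smooth
curve corresponding to `r = r^{(3)}` connects `P₀` to `P_∞` through the point `P_s`"): if for some
`r ∈ (r₃, r₄)` the trajectory issued from `P₀` (a solution of (1.8) which near `ξ = −∞` is
`(e^{−ξ}𝒲(e^ξ), −e^{−ξ}𝒲(−e^ξ))` for a profile `𝒲` analytic at `0` with `𝒲(0) > 0`) MEETS the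
analytic branch `(W^{(r)}, Z^{(r)})` through `P_s` at a branch time `s < 0` (the outcome of the
shooting argument of §6 fed by Proposition 4.1), and the branch continues for all positive times
off the sonic lines to `P_∞` (Proposition 3.1), then the three pieces glue (by local uniqueness)
into a global smooth solution `(W, Z) : ℝ → ℝ²` of (1.8) with `Z < W`, analytic origin germ and
limit `P_∞`, and `thm11_monatomic_of_WZ` yields the vendored Theorem 1.1
(`thm11_monatomic_of_meeting`). Theorems only.
[cite: BuckmasterCaolaboraGomezserrano2025, §6 (proof of Theorem 1.1), Prop. 2.3, Prop. 2.5, Prop. 3.1, Prop. 4.1]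
-/

noncomputable section

open Set Filter Metric Topology
open scoped ContDiff

namespace Literature.Analysis.FluidPDE

namespace BuckmasterCaolaboraGomezserrano2025

namespace Monatomic

open SonicSeries

variable {r : ℝ}

/-- Components of a solution of `c′ = field r c`. [folklore] -/
theorem hasDerivAt_fst_snd_of_field {c : ℝ → ℝ × ℝ} {ξ : ℝ} (h : HasDerivAt c (field r (c ξ)) ξ) :
    HasDerivAt (fun x => (c x).1) (NW r (c ξ).1 (c ξ).2 / DW (c ξ).1 (c ξ).2) ξ ∧
    HasDerivAt (fun x => (c x).2) (NZ r (c ξ).1 (c ξ).2 / DZ (c ξ).1 (c ξ).2) ξ :=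
  ⟨h.fst, h.snd⟩

/-- A solution of `c′ = field r c` on an open set off the sonic lines has `C^∞` components and
satisfies (1.8) in the multiplied form. [cite: BuckmasterCaolaboraGomezserrano2025, §1.3] -/
theorem smooth_of_field {c : ℝ → ℝ × ℝ} {S : Set ℝ} (hS : IsOpen S)
    (hc : ∀ ξ ∈ S, HasDerivAt c (field r (c ξ)) ξ)
    (hD : ∀ ξ ∈ S, DW (c ξ).1 (c ξ).2 ≠ 0 ∧ DZ (c ξ).1 (c ξ).2 ≠ 0) {ξ : ℝ} (hξ : ξ ∈ S) :
    ContDiffAt ℝ ∞ (fun x => (c x).1) ξ ∧ ContDiffAt ℝ ∞ (fun x => (c x).2) ξ ∧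
    DW (c ξ).1 (c ξ).2 * deriv (fun x => (c x).1) ξ = NW r (c ξ).1 (c ξ).2 ∧
    DZ (c ξ).1 (c ξ).2 * deriv (fun x => (c x).2) ξ = NZ r (c ξ).1 (c ξ).2 := by
  have h := contDiffAt_of_field (r := r) (W := fun x => (c x).1) (Z := fun x => (c x).2) hS
    (fun x hx => (hasDerivAt_fst_snd_of_field (hc x hx)).1)
    (fun x hx => (hasDerivAt_fst_snd_of_field (hc x hx)).2) (fun x hx => (hD x hx).1)
    (fun x hx => (hD x hx).2) hξ
  refine ⟨h.1, h.2, ?_, ?_⟩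
  · rw [(hasDerivAt_fst_snd_of_field (hc ξ hξ)).1.deriv, mul_div_cancel₀ _ (hD ξ hξ).1]
  · rw [(hasDerivAt_fst_snd_of_field (hc ξ hξ)).2.deriv, mul_div_cancel₀ _ (hD ξ hξ).2]

/-- The analytic branch through `P_s`, where it is off the sonic lines, solves `c′ = field r c`.
[cite: BuckmasterCaolaboraGomezserrano2025, Prop. 2.3] -/
theorem hasDerivAt_branch (h3 : r3 < r) (h4 : r < r4) {t : ℝ} (ht : |t| < sonicRad r)
    (hDW : DW (Wloc r t) (Zloc r t) ≠ 0) (hDZ : DZ (Wloc r t) (Zloc r t) ≠ 0) :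
    HasDerivAt (fun x => (Wloc r x, Zloc r x)) (field r (Wloc r t, Zloc r t)) t := by
  obtain ⟨hanW, hanZ, heW, heZ⟩ := (sonicSeries_spec' h3 h4).2.2.2.2 t ht
  have hW : HasDerivAt (Wloc r) (deriv (Wloc r) t) t := hanW.differentiableAt.hasDerivAt
  have hZ : HasDerivAt (Zloc r) (deriv (Zloc r) t) t := hanZ.differentiableAt.hasDerivAt
  have e1 : deriv (Wloc r) t = NW r (Wloc r t) (Zloc r t) / DW (Wloc r t) (Zloc r t) := by
    rw [eq_div_iff hDW, mul_comm]; exact heW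
  have e2 : deriv (Zloc r) t = NZ r (Wloc r t) (Zloc r t) / DZ (Wloc r t) (Zloc r t) := by
    rw [eq_div_iff hDZ, mul_comm]; exact heZ
  rw [e1] at hW; rw [e2] at hZ
  exact hW.prodMk hZ

/-- **Theorem 1.1 at `γ = 5/3` from a successful shooting.** Let `r ∈ (r₃, r₄)`. Suppose:
* (origin) `𝒲` is analytic at `0` with `𝒲(0) > 0`, and `c` solves (1.8) (`c′ = field r c`) on
  `(−∞, T)`, off both sonic lines with `Z < W`, and equals `(e^{−ξ}𝒲(e^ξ), −e^{−ξ}𝒲(−e^ξ))` for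
  `ξ ≤ ξ₁` (the trajectory issued from `P₀`, Prop. 2.5);
* (meeting) at some `ξm ∈ (ξ₁, T)`, `c(ξm)` is the point of branch time `s < 0`, `|s| < ρ(r)`, of the
  analytic branch `(W^{(r)}, Z^{(r)})` through `P_s` (the shooting conclusion of §6), the branch
  being off the sonic lines with `Z < W` for branch times in `[s, 0)`;
* (Prop. 3.1) the branch continues for all branch times `> 0` as a solution `(Wl, Zl)` off the
  sonic lines (`D_W, D_Z > 0`) with `Zl < Wl`, tending to `P_∞ = (0, 0)`.
Then `BuckmasterCaolaboraGomezserrano2025_thm11_monatomic` holds.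
[cite: BuckmasterCaolaboraGomezserrano2025, §6, Prop. 2.3, Prop. 2.5, Prop. 3.1, Prop. 4.1] -/
theorem thm11_monatomic_of_meeting (h3 : r3 < r) (h4 : r < r4)
    {𝒲 : ℝ → ℝ} (h𝒲 : AnalyticAt ℝ 𝒲 0) (h𝒲0 : 0 < 𝒲 0)
    {c : ℝ → ℝ × ℝ} {ξ₁ ξm T : ℝ} (hξ₁ : ξ₁ < ξm) (hT : ξm < T)
    (hgerm : ∀ ξ : ℝ, ξ ≤ ξ₁ → c ξ = (WofProfile 𝒲 ξ, ZofProfile 𝒲 ξ))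
    (hc : ∀ ξ ∈ Iio T, HasDerivAt c (field r (c ξ)) ξ)
    (hoff : ∀ ξ ∈ Iio T, 0 < DW (c ξ).1 (c ξ).2 ∧ DZ (c ξ).1 (c ξ).2 < 0 ∧ (c ξ).2 < (c ξ).1)
    {s : ℝ} (hs : s < 0) (hsρ : |s| < sonicRad r) (hmeet : c ξm = (Wloc r s, Zloc r s))
    (hsonic : ∀ t ∈ Ico s 0,
      0 < DW (Wloc r t) (Zloc r t) ∧ DZ (Wloc r t) (Zloc r t) < 0 ∧ Zloc r t < Wloc r t)
    {Wl Zl : ℝ → ℝ} {δ : ℝ} (hδ : 0 < δ)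
    (hbranch : ∀ t ∈ Ico 0 δ, Wl t = Wloc r t ∧ Zl t = Zloc r t)
    (hl : ∀ t ∈ Ioi (0 : ℝ), HasDerivAt (fun x => (Wl x, Zl x)) (field r (Wl t, Zl t)) t)
    (hloff : ∀ t ∈ Ioi (0 : ℝ), 0 < DW (Wl t) (Zl t) ∧ 0 < DZ (Wl t) (Zl t) ∧ Zl t < Wl t)
    (hlimW : Tendsto Wl atTop (𝓝 0)) (hlimZ : Tendsto Zl atTop (𝓝 0)) :
    BuckmasterCaolaboraGomezserrano2025_thm11_monatomic := by
  have hm := r3_r4_mem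
  have hr : r < rstar := h4.trans hm.2.2
  have hr2 : r < 2 := by linarith [rstar_lt]
  have hr₁ : (1.10102 : ℝ) < r := r3_bounds.1.trans h3
  have hr₂ : r < (1.13476 : ℝ) := h4.trans r4_bounds.2
  have hρ : 0 < sonicRad r := sonicRad_pos hr
  obtain ⟨hW0, hZ0, _, _, hspec⟩ := sonicSeries_spec' h3 h4
  -- the branch, shifted so that branch time `t` corresponds to `ξ = T₀ + t`, `T₀ = ξm - s`
  set T₀ : ℝ := ξm - s with hT₀
  set δ' : ℝ := min δ (sonicRad r) / 2 with hδ'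
  have hδ'pos : 0 < δ' := by positivity
  have hδ'δ : δ' < δ := by
    have := min_le_left δ (sonicRad r); simp only [hδ']; linarith
  have hδ'ρ : δ' < sonicRad r := by
    have := min_le_right δ (sonicRad r); simp only [hδ']; linarith
  set B : ℝ → ℝ × ℝ := fun x => (Wloc r (x - T₀), Zloc r (x - T₀)) with hB
  set L : ℝ → ℝ × ℝ := fun x => (Wl (x - T₀), Zl (x - T₀)) with hL
  set P : ℝ → ℝ × ℝ := fun x => if x < ξm then c x else if x < T₀ + δ' then B x else L x with hP
  -- local uniqueness at the meeting time: `c = B` near `ξm`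
  have hBm : B ξm = c ξm := by
    rw [hmeet]; simp only [hB]; congr 1 <;> congr 1 <;> simp only [hT₀] <;> ring
  have hcB : c =ᶠ[𝓝 ξm] B := by
    have h₁ : ∀ᶠ t in 𝓝 ξm, HasDerivAt c (field r (c t)) t :=
      Filter.eventually_of_mem (Iio_mem_nhds hT) fun t ht => hc t ht
    -- `B` is off the sonic lines near `ξm` (by continuity) and then solves the resolved ODE
    have hsρ' : |ξm - T₀| < sonicRad r := by simp only [hT₀]; rwa [show ξm - (ξm - s) = s by ring]
    have hcontB : ContinuousAt B ξm := by
      have hW := ((hspec _ hsρ').1.continuousAt).comp (f := fun x : ℝ => x - T₀)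
        (continuousAt_id.sub continuousAt_const)
      have hZ := ((hspec _ hsρ').2.1.continuousAt).comp (f := fun x : ℝ => x - T₀)
        (continuousAt_id.sub continuousAt_const)
      exact hW.prodMk hZ
    have hoffm := hoff ξm hT
    rw [← hBm] at hoffm
    have hc1 : ContinuousAt (fun t => (B t).1) ξm := hcontB.fst
    have hc2 : ContinuousAt (fun t => (B t).2) ξm := hcontB.snd
    have hDWc : ContinuousAt (fun t => DW (B t).1 (B t).2) ξm := by
      unfold DW
      exact continuousAt_const.add (((continuousAt_const.mul hc1).add hc2).div_const 3)
    have hDZc : ContinuousAt (fun t => DZ (B t).1 (B t).2) ξm := by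
      unfold DZ
      exact continuousAt_const.add ((hc1.add (continuousAt_const.mul hc2)).div_const 3)
    have hDWev : ∀ᶠ t in 𝓝 ξm, DW (B t).1 (B t).2 ≠ 0 := hDWc.eventually_ne hoffm.1.ne'
    have hDZev : ∀ᶠ t in 𝓝 ξm, DZ (B t).1 (B t).2 ≠ 0 := hDZc.eventually_ne hoffm.2.1.ne
    have hρev : ∀ᶠ t in 𝓝 ξm, |t - T₀| < sonicRad r :=
      (continuous_abs.continuousAt.comp (continuousAt_id.sub continuousAt_const)).eventually_lt
        continuousAt_const hsρ'
    have h₂ : ∀ᶠ t in 𝓝 ξm, HasDerivAt B (field r (B t)) t := by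
      filter_upwards [hDWev, hDZev, hρev] with t hDW hDZ hρt
      exact (hasDerivAt_branch h3 h4 hρt hDW hDZ).comp_sub_const t T₀
    exact eventuallyEq_of_field h₁ h₂ ⟨(hoff ξm hT).1.ne', (hoff ξm hT).2.1.ne⟩ hBm.symm
  -- local representations of `P`
  have hT₀m : ξm < T₀ + δ' := by simp only [hT₀]; linarith
  have hT₀ξm : ξm < T₀ := by simp only [hT₀]; linarith
  have repr_c : ∀ ξ, ξ < ξm → P =ᶠ[𝓝 ξ] c := fun ξ hξ =>
    Filter.eventually_of_mem (Iio_mem_nhds hξ) fun x hx => by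
      simp only [hP, if_pos (mem_Iio.mp hx)]
  have repr_B : ∀ ξ, ξm ≤ ξ → ξ < T₀ + δ' → P =ᶠ[𝓝 ξ] B := by
    intro ξ h1 h2
    rcases eq_or_lt_of_le h1 with heq | hlt
    · rw [← heq]
      have e2 : ∀ᶠ x in 𝓝 ξm, x < T₀ + δ' := Iio_mem_nhds hT₀m
      filter_upwards [hcB, e2] with x hx1 hx2
      by_cases hx : x < ξm
      · simp only [hP, if_pos hx]; exact hx1
      · simp only [hP, if_neg hx, if_pos hx2]
    · filter_upwards [Ioo_mem_nhds hlt h2] with x hx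
      simp only [hP, if_neg (not_lt.mpr hx.1.le), if_pos hx.2]
  have repr_L : ∀ ξ, T₀ + δ' ≤ ξ → P =ᶠ[𝓝 ξ] L := by
    intro ξ h1
    have e : ∀ᶠ x in 𝓝 ξ, T₀ < x := Ioi_mem_nhds (by linarith)
    filter_upwards [e] with x hx
    by_cases hx1 : x < ξm
    · exfalso; linarith
    · by_cases hx2 : x < T₀ + δ'
      · simp only [hP, if_neg hx1, if_pos hx2, hB, hL]
        have hb := hbranch (x - T₀) ⟨by linarith, by linarith⟩
        rw [hb.1, hb.2]
      · simp only [hP, if_neg hx1, if_neg hx2]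
  -- facts about the three representatives
  have hD : ∀ ξ ∈ Iio T, DW (c ξ).1 (c ξ).2 ≠ 0 ∧ DZ (c ξ).1 (c ξ).2 ≠ 0 := fun ξ hξ =>
    ⟨(hoff ξ hξ).1.ne', (hoff ξ hξ).2.1.ne⟩
  set cl : ℝ → ℝ × ℝ := fun x => (Wl x, Zl x) with hcl
  have hlD : ∀ t ∈ Ioi (0 : ℝ), DW (cl t).1 (cl t).2 ≠ 0 ∧ DZ (cl t).1 (cl t).2 ≠ 0 := fun t ht =>
    ⟨(hloff t ht).1.ne', (hloff t ht).2.1.ne'⟩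
  have hl' : ∀ t ∈ Ioi (0 : ℝ), HasDerivAt cl (field r (cl t)) t := fun t ht => hl t ht
  -- branch-time bounds in the middle region
  have hmid : ∀ ξ, ξm ≤ ξ → ξ < T₀ + δ' → s ≤ ξ - T₀ ∧ ξ - T₀ < δ' ∧ |ξ - T₀| < sonicRad r := by
    intro ξ h1 h2
    have k1 : s ≤ ξ - T₀ := by simp only [hT₀]; linarith
    have k2 : ξ - T₀ < δ' := by linarith
    refine ⟨k1, k2, abs_lt.mpr ⟨?_, by linarith⟩⟩
    have : -sonicRad r < s := (abs_lt.mp hsρ).1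
    linarith
  -- the global solution
  set W : ℝ → ℝ := fun x => (P x).1 with hWdef
  set Z : ℝ → ℝ := fun x => (P x).2 with hZdef
  have evW : ∀ {ξ : ℝ} {R : ℝ → ℝ × ℝ}, P =ᶠ[𝓝 ξ] R → W =ᶠ[𝓝 ξ] fun x => (R x).1 :=
    fun h => h.mono fun x hx => by simp only [hWdef, hx]
  have evZ : ∀ {ξ : ℝ} {R : ℝ → ℝ × ℝ}, P =ᶠ[𝓝 ξ] R → Z =ᶠ[𝓝 ξ] fun x => (R x).2 :=
    fun h => h.mono fun x hx => by simp only [hZdef, hx]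
  -- (1)+(2): smoothness and the equations, pointwise
  have key : ∀ ξ : ℝ, (ContDiffAt ℝ ∞ W ξ ∧ ContDiffAt ℝ ∞ Z ξ) ∧
      (DW (W ξ) (Z ξ) * deriv W ξ = NW r (W ξ) (Z ξ) ∧
       DZ (W ξ) (Z ξ) * deriv Z ξ = NZ r (W ξ) (Z ξ)) ∧ Z ξ < W ξ := by
    intro ξ
    rcases lt_or_ge ξ ξm with h1 | h1
    · -- region of `c`
      have hrep := repr_c ξ h1
      have hξT : ξ ∈ Iio T := h1.trans hT
      obtain ⟨sW, sZ, eW, eZ⟩ := smooth_of_field isOpen_Iio hc hD hξT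
      have hWv : W ξ = (c ξ).1 := by simp only [hWdef, hrep.self_of_nhds]
      have hZv : Z ξ = (c ξ).2 := by simp only [hZdef, hrep.self_of_nhds]
      refine ⟨⟨sW.congr_of_eventuallyEq (evW hrep), sZ.congr_of_eventuallyEq (evZ hrep)⟩, ⟨?_, ?_⟩, ?_⟩
      · rw [(evW hrep).deriv_eq, hWv, hZv]; exact eW
      · rw [(evZ hrep).deriv_eq, hWv, hZv]; exact eZ
      · rw [hWv, hZv]; exact (hoff ξ hξT).2.2
    · rcases lt_or_ge ξ (T₀ + δ') with h2 | h2
      · -- region of the analytic branch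
        have hrep := repr_B ξ h1 h2
        obtain ⟨k1, k2, k3⟩ := hmid ξ h1 h2
        obtain ⟨hanW, hanZ, heW, heZ⟩ := hspec (ξ - T₀) k3
        have hWv : W ξ = Wloc r (ξ - T₀) := by simp only [hWdef, hrep.self_of_nhds, hB]
        have hZv : Z ξ = Zloc r (ξ - T₀) := by simp only [hZdef, hrep.self_of_nhds, hB]
        have hshift : ContDiffAt ℝ ∞ (fun x : ℝ => x - T₀) ξ := contDiffAt_id.sub contDiffAt_const
        have aW : ContDiffAt ℝ ∞ (Wloc r) (ξ - T₀) := hanW.contDiffAt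
        have aZ : ContDiffAt ℝ ∞ (Zloc r) (ξ - T₀) := hanZ.contDiffAt
        have cW := aW.comp ξ hshift
        have cZ := aZ.comp ξ hshift
        refine ⟨⟨?_, ?_⟩, ⟨?_, ?_⟩, ?_⟩
        · exact cW.congr_of_eventuallyEq (evW hrep)
        · exact cZ.congr_of_eventuallyEq (evZ hrep)
        · rw [(evW hrep).deriv_eq, hWv, hZv]
          simp only [hB]
          rw [deriv_comp_sub_const]; exact heW
        · rw [(evZ hrep).deriv_eq, hWv, hZv]
          simp only [hB]
          rw [deriv_comp_sub_const]; exact heZ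
        · rw [hWv, hZv]
          rcases lt_trichotomy (ξ - T₀) 0 with ht | ht | ht
          · exact (hsonic _ ⟨k1, ht⟩).2.2
          · rw [ht, hW0, hZ0]; unfold W0 Z0; linarith [q_nonneg r]
          · have hb := hbranch (ξ - T₀) ⟨ht.le, k2.trans hδ'δ⟩
            rw [← hb.1, ← hb.2]; exact (hloff _ ht).2.2
      · -- region of the continuation `(Wl, Zl)`
        have hrep := repr_L ξ h2
        have ht : ξ - T₀ ∈ Ioi (0 : ℝ) := by rw [Set.mem_Ioi]; linarith
        obtain ⟨sW, sZ, eW, eZ⟩ := smooth_of_field isOpen_Ioi hl' hlD ht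
        have hWv : W ξ = Wl (ξ - T₀) := by simp only [hWdef, hrep.self_of_nhds, hL]
        have hZv : Z ξ = Zl (ξ - T₀) := by simp only [hZdef, hrep.self_of_nhds, hL]
        have hshift : ContDiffAt ℝ ∞ (fun x : ℝ => x - T₀) ξ := contDiffAt_id.sub contDiffAt_const
        have cW : ContDiffAt ℝ ∞ (fun x => Wl (x - T₀)) ξ := sW.comp ξ hshift
        have cZ : ContDiffAt ℝ ∞ (fun x => Zl (x - T₀)) ξ := sZ.comp ξ hshift
        refine ⟨⟨?_, ?_⟩, ⟨?_, ?_⟩, ?_⟩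
        · exact cW.congr_of_eventuallyEq (evW hrep)
        · exact cZ.congr_of_eventuallyEq (evZ hrep)
        · rw [(evW hrep).deriv_eq, hWv, hZv]
          simp only [hL]
          rw [deriv_comp_sub_const]; exact eW
        · rw [(evZ hrep).deriv_eq, hWv, hZv]
          simp only [hL]
          rw [deriv_comp_sub_const]; exact eZ
        · rw [hWv, hZv]; exact (hloff _ ht).2.2
  have hWsm : ContDiff ℝ ∞ W := contDiff_iff_contDiffAt.mpr fun ξ => (key ξ).1.1
  have hZsm : ContDiff ℝ ∞ Z := contDiff_iff_contDiffAt.mpr fun ξ => (key ξ).1.2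
  -- (4) limits
  have hevL : ∀ᶠ x in atTop, P x = L x := by
    filter_upwards [eventually_ge_atTop (T₀ + δ')] with x hx
    exact (repr_L x hx).self_of_nhds
  have hshiftT : Tendsto (fun x : ℝ => x - T₀) atTop atTop :=
    (tendsto_atTop_add_const_right atTop (-T₀) tendsto_id).congr fun x => by
      simp only [id, sub_eq_add_neg]
  have hlimW' : Tendsto W atTop (𝓝 0) := by
    refine (hlimW.comp hshiftT).congr' ?_
    filter_upwards [hevL] with x hx
    simp only [hWdef, hx, hL, Function.comp_apply]
  have hlimZ' : Tendsto Z atTop (𝓝 0) := by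
    refine (hlimZ.comp hshiftT).congr' ?_
    filter_upwards [hevL] with x hx
    simp only [hZdef, hx, hL, Function.comp_apply]
  -- (5) the origin germ
  have horigin : ∀ ζ ∈ Ioo 0 (Real.exp ξ₁),
      ζ * W (Real.log ζ) = 𝒲 ζ ∧ -ζ * Z (Real.log ζ) = 𝒲 (-ζ) := by
    intro ζ hζ
    have hlog : Real.log ζ < ξ₁ := by
      rw [Real.log_lt_iff_lt_exp hζ.1]; exact hζ.2
    have hPc : P (Real.log ζ) = c (Real.log ζ) := (repr_c _ (hlog.trans hξ₁)).self_of_nhds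
    have hcg := hgerm (Real.log ζ) hlog.le
    have hWv : W (Real.log ζ) = WofProfile 𝒲 (Real.log ζ) := by simp only [hWdef, hPc, hcg]
    have hZv : Z (Real.log ζ) = ZofProfile 𝒲 (Real.log ζ) := by simp only [hZdef, hPc, hcg]
    rw [hWv, hZv]
    unfold WofProfile ZofProfile
    rw [Real.exp_neg, Real.exp_log hζ.1]
    have hζ0 : ζ ≠ 0 := hζ.1.ne'
    constructor
    · field_simp
    · field_simp
  -- (6) conclude
  refine thm11_monatomic_of_WZ hr₁ hr₂ hWsm hZsm (fun ξ => ?_) (fun ξ => ?_) (fun ξ => (key ξ).2.2)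
    hlimW' hlimZ' h𝒲 h𝒲0 (Real.exp_pos ξ₁) horigin
  · have := (key ξ).2.1.1; unfold DW NW at this; exact this
  · have := (key ξ).2.1.2; unfold DZ NZ at this; exact this

end Monatomic

end BuckmasterCaolaboraGomezserrano2025

end Literature.Analysis.FluidPDE
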